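import Summits.HodgeConjecture.CorCM.TwoGroupClassTwoTable
import Summits.HodgeConjecture.CorCM.TwoGroupCyclicEightTimesTwoActionTableInj
import HarnessLib

/-!
# The table of `C(u)·2` on `𝔽₂⁵`: centraliser of an involution with two conjugates, exponent-`4` quotient case

COR-CM (cell `pub-hodgecm2`), binder seat b04 (gen 36), count-neutral own lane «Galois-CM-type classification».  KERNEL ONLY:
theorems; no definition, no named fact, no `sorry`.  Pure group theory for «case A» of the ORDER-`32` BASE programme (A7-JUNCTION
gen-36 addendum §F, family CA2).  `|G| = 32`; `c ≠ 1` a central involution; `u` an involution (`u ∉ {1, c}`) whose centraliser `M`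
contains `a, b` with `a ∉ N = ⟨u, c⟩`, `b ∉ N⟨a⟩` and `a² = u^{α₁}c^{α₂}`, `b² = u^{β₁}c^{β₂}`, `b a = a b u^{γ₁}c^{γ₂}` (so
`M = N{1,a,b,ab}` has class `≤ 2` over the central four-group `N`); `x` with `x u = u c x` (the second conjugate of `u` is `uc`),
`x a = u^{p₁}c^{q₁}a^{e₁}b^{e₂} x`, `x b = u^{p₂}c^{q₂}a^{e₃}b^{e₄} x`, `x² = u^{p₃}c^{q₃}a^{e₅}b^{e₆}` (eighteen bits).  The word
map `(p,q,i,j,k) ↦ uᵖ c^q aⁱ bʲ xᵏ` inverts to a table model `e : G ≃ 𝔽₂⁵` with an explicit polynomial law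
(`exists_table_centraliser_extension`): the law is the normal form produced by the oriented collection rules of §1 (read off the
kernel), the word map is shown injective directly.  The case-A groups with such a `u` whose `M/N ≅ C₂²`: census #19 (`Hol C₈`),
#22, #37 (`C₄ ≀ C₂`), #38, #39, #42 — `CorCM/GaloisThirtyTwoCentraliserExtensionCertificates` decides their certificates.

## References

* [Rotman1995] J. J. Rotman, *An Introduction to the Theory of Groups*, 4th ed., GTM 148, Ch. 5 and Ch. 7 (extensions).
* [Shimura1998] G. Shimura, *Abelian Varieties with Complex Multiplication and Modular Functions*, §8.2.
-/

namespace Summit.HodgeConjecture.CorCM.GaloisModels.CentraliserExtension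

open Summit.HodgeConjecture.CorCM.GaloisTableLaws (zmod2_cases)
open Summit.HodgeConjecture.CorCM.GaloisModels.FrattiniTwo (invol_pow_add)
open Summit.HodgeConjecture.CorCM.GaloisModels.ClassTwo (invol_pow_add_tail)
open Summit.HodgeConjecture.CorCM.GaloisModels.CyclicEightTimesTwo (exists_table_equiv_of_words_inj)

variable {G : Type*} [Group G]

/-! ## §1 Collection rules for bit powers -/

/-- Powers of commuting letters pass each other (with a tail). [folklore] -/
theorem comm_bits {g h : G} (hgh : g * h = h * g) (m n : ℕ) (R : G) : g ^ m * (h ^ n * R) = h ^ n * (g ^ m * R) :=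
  ((show Commute g h from hgh).pow_pow m n).left_comm R

/-- `x a = u^{p₁} c^{q₁} a^{e₁} b^{e₂} x` ⟹ the rule moving `xᵏ` past `aⁱ` (bits). [folklore] -/
theorem act_bits {u c a b x : G} {p₁ q₁ e₁ e₂ : ZMod 2}
    (hxa : x * a = u ^ p₁.val * c ^ q₁.val * a ^ e₁.val * b ^ e₂.val * x) (k i : ZMod 2) (R : G) :
    x ^ k.val * (a ^ i.val * R) =
      u ^ (p₁ * (k * i)).val * (c ^ (q₁ * (k * i)).val * (a ^ (i + k * i + e₁ * (k * i)).val *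
        (b ^ (e₂ * (k * i)).val * (x ^ k.val * R)))) := by
  have hv0 : (0 : ZMod 2).val = 0 := rfl
  have hv1 : (1 : ZMod 2).val = 1 := rfl
  have h11 : ((1 : ZMod 2) + 1).val = 0 := rfl
  rcases zmod2_cases k with rfl | rfl <;> rcases zmod2_cases i with rfl | rfl <;>
    simp only [hv0, hv1, mul_zero, mul_one, add_zero, pow_zero, pow_one, one_mul, mul_one]
  · -- k = 1, i = 1 : `1 + 1 + e₁` exponent
    rw [← mul_assoc x a R, hxa]
    simp only [mul_assoc]
    congr 2
    rw [show ((1 : ZMod 2) + 1 + e₁) = e₁ by ring_nf; rw [show (2 : ZMod 2) = 0 from rfl, zero_add]]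

/-- `a a = u^{α₁} c^{α₂}` ⟹ the square rule for bit powers. [folklore] -/
theorem sq_bits {u c a : G} {α₁ α₂ : ZMod 2} (haa : a * a = u ^ α₁.val * c ^ α₂.val) (i i' : ZMod 2) (R : G) :
    a ^ i.val * (a ^ i'.val * R) = u ^ (α₁ * (i * i')).val * (c ^ (α₂ * (i * i')).val * (a ^ (i + i').val * R)) := by
  have hv0 : (0 : ZMod 2).val = 0 := rfl
  have hv1 : (1 : ZMod 2).val = 1 := rfl
  have h11 : ((1 : ZMod 2) + 1).val = 0 := rfl
  rcases zmod2_cases i with rfl | rfl <;> rcases zmod2_cases i' with rfl | rfl <;>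
    simp only [hv0, hv1, h11, mul_zero, mul_one, zero_add, add_zero, pow_zero, pow_one, one_mul, mul_one]
  rw [← mul_assoc a a R, haa, mul_assoc]

/-- `b a = a b (u^{γ₁} c^{γ₂})` ⟹ the swap rule for bit powers. [folklore] -/
theorem swap_bits {u c a b : G} {γ₁ γ₂ : ZMod 2} (hba : b * a = a * b * (u ^ γ₁.val * c ^ γ₂.val)) (j i : ZMod 2) (R : G) :
    b ^ j.val * (a ^ i.val * R) = a ^ i.val * (b ^ j.val * (u ^ (γ₁ * (j * i)).val * (c ^ (γ₂ * (j * i)).val * R))) := by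
  have hv0 : (0 : ZMod 2).val = 0 := rfl
  have hv1 : (1 : ZMod 2).val = 1 := rfl
  rcases zmod2_cases j with rfl | rfl <;> rcases zmod2_cases i with rfl | rfl <;>
    simp only [hv0, hv1, mul_zero, mul_one, pow_zero, pow_one, one_mul, mul_one]
  rw [← mul_assoc b a R, hba]
  simp only [mul_assoc]

/-- `x u = u c x` ⟹ the rule moving `xᵏ` past `uᵖ`. [folklore] -/
theorem xu_bits {u c x : G} (hxu : x * u = u * c * x) (k p : ZMod 2) (R : G) :
    x ^ k.val * (u ^ p.val * R) = u ^ p.val * (c ^ (k * p).val * (x ^ k.val * R)) := by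
  have hv0 : (0 : ZMod 2).val = 0 := rfl
  have hv1 : (1 : ZMod 2).val = 1 := rfl
  rcases zmod2_cases k with rfl | rfl <;> rcases zmod2_cases p with rfl | rfl <;>
    simp only [hv0, hv1, mul_zero, mul_one, pow_zero, pow_one, one_mul, mul_one]
  rw [← mul_assoc x u R, hxu]
  simp only [mul_assoc]

/-- `x x = u^{p₃} c^{q₃} a^{e₅} b^{e₆}` ⟹ the rule for `xᵏ xᵏ'` (with a tail). [folklore] -/
theorem xx_bits {u c a b x : G} {p₃ q₃ e₅ e₆ : ZMod 2} (hxx : x * x = u ^ p₃.val * c ^ q₃.val * a ^ e₅.val * b ^ e₆.val)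
    (k k' : ZMod 2) (R : G) :
    x ^ k.val * (x ^ k'.val * R) = u ^ (p₃ * (k * k')).val * (c ^ (q₃ * (k * k')).val * (a ^ (e₅ * (k * k')).val *
      (b ^ (e₆ * (k * k')).val * (x ^ (k + k').val * R)))) := by
  have hv0 : (0 : ZMod 2).val = 0 := rfl
  have hv1 : (1 : ZMod 2).val = 1 := rfl
  have h11 : ((1 : ZMod 2) + 1).val = 0 := rfl
  rcases zmod2_cases k with rfl | rfl <;> rcases zmod2_cases k' with rfl | rfl <;>
    simp only [hv0, hv1, h11, mul_zero, mul_one, zero_add, add_zero, pow_zero, pow_one, one_mul, mul_one]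
  rw [← mul_assoc x x R, hxx]
  simp only [mul_assoc]

/-- `x b = u^{p₂} c^{q₂} a^{e₃} b^{e₄} x` ⟹ the rule moving `xᵏ` past `bʲ` (bits). [folklore] -/
theorem act_bits_b {u c a b x : G} {p₂ q₂ e₃ e₄ : ZMod 2}
    (hxb : x * b = u ^ p₂.val * c ^ q₂.val * a ^ e₃.val * b ^ e₄.val * x) (k j : ZMod 2) (R : G) :
    x ^ k.val * (b ^ j.val * R) =
      u ^ (p₂ * (k * j)).val * (c ^ (q₂ * (k * j)).val * (a ^ (e₃ * (k * j)).val *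
        (b ^ (j + k * j + e₄ * (k * j)).val * (x ^ k.val * R)))) := by
  have hv0 : (0 : ZMod 2).val = 0 := rfl
  have hv1 : (1 : ZMod 2).val = 1 := rfl
  have h11 : ((1 : ZMod 2) + 1).val = 0 := rfl
  rcases zmod2_cases k with rfl | rfl <;> rcases zmod2_cases j with rfl | rfl <;>
    simp only [hv0, hv1, mul_zero, mul_one, add_zero, pow_zero, pow_one, one_mul, mul_one]
  · rw [← mul_assoc x b R, hxb]
    simp only [mul_assoc]
    congr 3
    rw [show ((1 : ZMod 2) + 1 + e₄) = e₄ by ring_nf; rw [show (2 : ZMod 2) = 0 from rfl, zero_add]]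

/-- The rule for `xᵏ xᵏ'` without a tail. [folklore] -/
theorem xx_bits' {u c a b x : G} {p₃ q₃ e₅ e₆ : ZMod 2} (hxx : x * x = u ^ p₃.val * c ^ q₃.val * a ^ e₅.val * b ^ e₆.val)
    (k k' : ZMod 2) :
    x ^ k.val * x ^ k'.val = u ^ (p₃ * (k * k')).val * (c ^ (q₃ * (k * k')).val * (a ^ (e₅ * (k * k')).val *
      (b ^ (e₆ * (k * k')).val * x ^ (k + k').val))) := by
  have h := xx_bits hxx k k' 1
  simpa only [mul_one] using h

/-- Inverse of a bit power: `a a = u^{α₁} c^{α₂}` (involutions `u, c` commuting with `a`) ⟹ `(aⁱ)⁻¹ = aⁱ u^{α₁ i} c^{α₂ i}`.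
[folklore] -/
theorem inv_bits {u c a : G} {α₁ α₂ : ZMod 2} (huu : u * u = 1) (hcc : c * c = 1) (hcu : c * u = u * c)
    (haa : a * a = u ^ α₁.val * c ^ α₂.val) (i : ZMod 2) :
    (a ^ i.val)⁻¹ = a ^ i.val * (u ^ (α₁ * i).val * c ^ (α₂ * i).val) := by
  have hv0 : (0 : ZMod 2).val = 0 := rfl
  have hv1 : (1 : ZMod 2).val = 1 := rfl
  rcases zmod2_cases i with rfl | rfl
  · simp only [hv0, mul_zero, pow_zero, inv_one, mul_one]
  · simp only [hv1, mul_one, pow_one]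
    rw [inv_eq_iff_mul_eq_one, ← mul_assoc, haa]
    calc u ^ α₁.val * c ^ α₂.val * (u ^ α₁.val * c ^ α₂.val)
        = u ^ α₁.val * (c ^ α₂.val * u ^ α₁.val) * c ^ α₂.val := by simp only [mul_assoc]
      _ = u ^ α₁.val * (u ^ α₁.val * c ^ α₂.val) * c ^ α₂.val := by
          rw [((show Commute c u from hcu).pow_pow _ _).eq]
      _ = (u ^ α₁.val * u ^ α₁.val) * (c ^ α₂.val * c ^ α₂.val) := by simp only [mul_assoc]
      _ = 1 := by
          rw [← invol_pow_add huu, ← invol_pow_add hcc]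
          have h2 : ∀ z : ZMod 2, (z + z).val = 0 := by decide
          rw [h2, h2, pow_zero, pow_zero, one_mul]

/-! ## §2 The table model -/

variable [Finite G]

/-- **Table model for the centraliser extension `C(u)·2`.**  `|G| = 32`; `c ≠ 1` central involution, `u` an involution with
`u ≠ c^q`; `a, b` commuting with `u`, `a ≠ uᵖc^q`, `b ≠ uᵖ(c^q aⁱ)`; the eighteen-bit relations of the module docstring; `mul` the
polynomial law below (the collected normal form).  Then `e : G ≃ 𝔽₂⁵` with `e(gh) = mul (e g) (e h)` and
`e (uᵖ c^q aⁱ bʲ xᵏ) = (p, q, i, j, k)`. [cite: Rotman1995, Ch. 5] -/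
theorem exists_table_centraliser_extension {u c a b x : G} (hcc : c * c = 1) (hc1 : c ≠ 1)
    (hcen : ∀ g : G, c * g = g * c) (huu : u * u = 1) (hu : ∀ q : ZMod 2, u ≠ c ^ q.val) (hua : a * u = u * a)
    (hub : b * u = u * b) (ha : ∀ p q : ZMod 2, a ≠ u ^ p.val * c ^ q.val)
    (hb : ∀ p q i : ZMod 2, b ≠ u ^ p.val * (c ^ q.val * a ^ i.val))
    (α₁ α₂ β₁ β₂ γ₁ γ₂ p₁ q₁ e₁ e₂ p₂ q₂ e₃ e₄ p₃ q₃ e₅ e₆ : ZMod 2)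
    (haa : a * a = u ^ α₁.val * c ^ α₂.val) (hbb : b * b = u ^ β₁.val * c ^ β₂.val)
    (hba : b * a = a * b * (u ^ γ₁.val * c ^ γ₂.val)) (hxu : x * u = u * c * x)
    (hxa : x * a = u ^ p₁.val * c ^ q₁.val * a ^ e₁.val * b ^ e₂.val * x)
    (hxb : x * b = u ^ p₂.val * c ^ q₂.val * a ^ e₃.val * b ^ e₄.val * x)
    (hxx : x * x = u ^ p₃.val * c ^ q₃.val * a ^ e₅.val * b ^ e₆.val) (hcard : Nat.card G = 32)
    (mul : ZMod 2 × ZMod 2 × ZMod 2 × ZMod 2 × ZMod 2 → ZMod 2 × ZMod 2 × ZMod 2 × ZMod 2 × ZMod 2 →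
      ZMod 2 × ZMod 2 × ZMod 2 × ZMod 2 × ZMod 2)
    (hm : ∀ P Q : ZMod 2 × ZMod 2 × ZMod 2 × ZMod 2 × ZMod 2, mul P Q =
      (P.1 + (Q.1 + (p₁ * (P.2.2.2.2 * Q.2.2.1) + (p₂ * (P.2.2.2.2 * Q.2.2.2.1) + (p₃ * (P.2.2.2.2 * Q.2.2.2.2) + (γ₁
        * ((Q.2.2.2.1 + P.2.2.2.2 * Q.2.2.2.1 + e₄ * (P.2.2.2.2 * Q.2.2.2.1)) * (e₅ * (P.2.2.2.2 *
        Q.2.2.2.2))) + β₁ * ((Q.2.2.2.1 + P.2.2.2.2 * Q.2.2.2.1 + e₄ * (P.2.2.2.2 * Q.2.2.2.1)) * (e₆ *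
        (P.2.2.2.2 * Q.2.2.2.2)))) + α₁ * (e₃ * (P.2.2.2.2 * Q.2.2.2.1) * (e₅ * (P.2.2.2.2 * Q.2.2.2.2)))) +
        (γ₁ * (e₂ * (P.2.2.2.2 * Q.2.2.1) * (e₃ * (P.2.2.2.2 * Q.2.2.2.1) + e₅ * (P.2.2.2.2 * Q.2.2.2.2))) +
        β₁ * (e₂ * (P.2.2.2.2 * Q.2.2.1) * (Q.2.2.2.1 + P.2.2.2.2 * Q.2.2.2.1 + e₄ * (P.2.2.2.2 * Q.2.2.2.1) +
        e₆ * (P.2.2.2.2 * Q.2.2.2.2)))) + α₁ * ((Q.2.2.1 + P.2.2.2.2 * Q.2.2.1 + e₁ * (P.2.2.2.2 * Q.2.2.1)) *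
        (e₃ * (P.2.2.2.2 * Q.2.2.2.1) + e₅ * (P.2.2.2.2 * Q.2.2.2.2))))) + (γ₁ * (P.2.2.2.1 * (Q.2.2.1 +
        P.2.2.2.2 * Q.2.2.1 + e₁ * (P.2.2.2.2 * Q.2.2.1) + (e₃ * (P.2.2.2.2 * Q.2.2.2.1) + e₅ * (P.2.2.2.2 *
        Q.2.2.2.2)))) + β₁ * (P.2.2.2.1 * (e₂ * (P.2.2.2.2 * Q.2.2.1) + (Q.2.2.2.1 + P.2.2.2.2 * Q.2.2.2.1 +
        e₄ * (P.2.2.2.2 * Q.2.2.2.1) + e₆ * (P.2.2.2.2 * Q.2.2.2.2))))) + α₁ * (P.2.2.1 * (Q.2.2.1 + P.2.2.2.2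
        * Q.2.2.1 + e₁ * (P.2.2.2.2 * Q.2.2.1) + (e₃ * (P.2.2.2.2 * Q.2.2.2.1) + e₅ * (P.2.2.2.2 *
        Q.2.2.2.2))))),
        P.2.1 + (P.2.2.2.2 * Q.1 + (Q.2.1 + (q₁ * (P.2.2.2.2 * Q.2.2.1) + (q₂ * (P.2.2.2.2 * Q.2.2.2.1) + (q₃ *
        (P.2.2.2.2 * Q.2.2.2.2) + (γ₂ * ((Q.2.2.2.1 + P.2.2.2.2 * Q.2.2.2.1 + e₄ * (P.2.2.2.2 * Q.2.2.2.1)) *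
        (e₅ * (P.2.2.2.2 * Q.2.2.2.2))) + β₂ * ((Q.2.2.2.1 + P.2.2.2.2 * Q.2.2.2.1 + e₄ * (P.2.2.2.2 *
        Q.2.2.2.1)) * (e₆ * (P.2.2.2.2 * Q.2.2.2.2)))) + α₂ * (e₃ * (P.2.2.2.2 * Q.2.2.2.1) * (e₅ * (P.2.2.2.2
        * Q.2.2.2.2)))) + (γ₂ * (e₂ * (P.2.2.2.2 * Q.2.2.1) * (e₃ * (P.2.2.2.2 * Q.2.2.2.1) + e₅ * (P.2.2.2.2
        * Q.2.2.2.2))) + β₂ * (e₂ * (P.2.2.2.2 * Q.2.2.1) * (Q.2.2.2.1 + P.2.2.2.2 * Q.2.2.2.1 + e₄ *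
        (P.2.2.2.2 * Q.2.2.2.1) + e₆ * (P.2.2.2.2 * Q.2.2.2.2)))) + α₂ * ((Q.2.2.1 + P.2.2.2.2 * Q.2.2.1 + e₁
        * (P.2.2.2.2 * Q.2.2.1)) * (e₃ * (P.2.2.2.2 * Q.2.2.2.1) + e₅ * (P.2.2.2.2 * Q.2.2.2.2)))))) + (γ₂ *
        (P.2.2.2.1 * (Q.2.2.1 + P.2.2.2.2 * Q.2.2.1 + e₁ * (P.2.2.2.2 * Q.2.2.1) + (e₃ * (P.2.2.2.2 *
        Q.2.2.2.1) + e₅ * (P.2.2.2.2 * Q.2.2.2.2)))) + β₂ * (P.2.2.2.1 * (e₂ * (P.2.2.2.2 * Q.2.2.1) +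
        (Q.2.2.2.1 + P.2.2.2.2 * Q.2.2.2.1 + e₄ * (P.2.2.2.2 * Q.2.2.2.1) + e₆ * (P.2.2.2.2 * Q.2.2.2.2))))) +
        α₂ * (P.2.2.1 * (Q.2.2.1 + P.2.2.2.2 * Q.2.2.1 + e₁ * (P.2.2.2.2 * Q.2.2.1) + (e₃ * (P.2.2.2.2 *
        Q.2.2.2.1) + e₅ * (P.2.2.2.2 * Q.2.2.2.2))))),
        P.2.2.1 + (Q.2.2.1 + P.2.2.2.2 * Q.2.2.1 + e₁ * (P.2.2.2.2 * Q.2.2.1) + (e₃ * (P.2.2.2.2 * Q.2.2.2.1) + e₅ *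
        (P.2.2.2.2 * Q.2.2.2.2))),
        P.2.2.2.1 + (e₂ * (P.2.2.2.2 * Q.2.2.1) + (Q.2.2.2.1 + P.2.2.2.2 * Q.2.2.2.1 + e₄ * (P.2.2.2.2 * Q.2.2.2.1) +
        e₆ * (P.2.2.2.2 * Q.2.2.2.2))),
        P.2.2.2.2 + Q.2.2.2.2)) :
    ∃ e : G ≃ ZMod 2 × ZMod 2 × ZMod 2 × ZMod 2 × ZMod 2, (∀ g h : G, e (g * h) = mul (e g) (e h)) ∧
      ∀ P : ZMod 2 × ZMod 2 × ZMod 2 × ZMod 2 × ZMod 2,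
        e (u ^ P.1.val * c ^ P.2.1.val * a ^ P.2.2.1.val * b ^ P.2.2.2.1.val * x ^ P.2.2.2.2.val) = P := by
  have hv0 : (0 : ZMod 2).val = 0 := rfl
  have hv1 : (1 : ZMod 2).val = 1 := rfl
  -- oriented rules
  have hcx : c * x = x * c := hcen x
  have XA := act_bits hxa
  have XB := act_bits_b hxb
  have XU := xu_bits hxu
  have XC : ∀ (k q : ZMod 2) (R : G), x ^ k.val * (c ^ q.val * R) = c ^ q.val * (x ^ k.val * R) :=
    fun k q R => comm_bits hcx.symm _ _ R
  have XX := xx_bits hxx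
  have XX' := xx_bits' hxx
  have AA := sq_bits haa
  have BB := sq_bits (a := b) hbb
  have BA := swap_bits hba
  have AU : ∀ (i p : ZMod 2) (R : G), a ^ i.val * (u ^ p.val * R) = u ^ p.val * (a ^ i.val * R) :=
    fun i p R => comm_bits hua _ _ R
  have BU : ∀ (j p : ZMod 2) (R : G), b ^ j.val * (u ^ p.val * R) = u ^ p.val * (b ^ j.val * R) :=
    fun j p R => comm_bits hub _ _ R
  have AC : ∀ (i q : ZMod 2) (R : G), a ^ i.val * (c ^ q.val * R) = c ^ q.val * (a ^ i.val * R) :=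
    fun i q R => comm_bits (hcen a).symm _ _ R
  have BC : ∀ (j q : ZMod 2) (R : G), b ^ j.val * (c ^ q.val * R) = c ^ q.val * (b ^ j.val * R) :=
    fun j q R => comm_bits (hcen b).symm _ _ R
  have CU : ∀ (q p : ZMod 2) (R : G), c ^ q.val * (u ^ p.val * R) = u ^ p.val * (c ^ q.val * R) :=
    fun q p R => comm_bits (hcen u) _ _ R
  have UU := invol_pow_add_tail huu
  have CC := invol_pow_add_tail hcc
  -- tail-free variants for words ending without `x`
  have AU' : ∀ i p : ZMod 2, a ^ i.val * u ^ p.val = u ^ p.val * a ^ i.val := fun i p =>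
    ((show Commute a u from hua).pow_pow _ _).eq
  have BU' : ∀ j p : ZMod 2, b ^ j.val * u ^ p.val = u ^ p.val * b ^ j.val := fun j p =>
    ((show Commute b u from hub).pow_pow _ _).eq
  have CU' : ∀ q p : ZMod 2, c ^ q.val * u ^ p.val = u ^ p.val * c ^ q.val := fun q p =>
    ((show Commute c u from hcen u).pow_pow _ _).eq
  have AC' : ∀ i q : ZMod 2, a ^ i.val * c ^ q.val = c ^ q.val * a ^ i.val := fun i q =>
    ((show Commute a c from (hcen a).symm).pow_pow _ _).eq
  have BC' : ∀ j q : ZMod 2, b ^ j.val * c ^ q.val = c ^ q.val * b ^ j.val := fun j q =>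
    ((show Commute b c from (hcen b).symm).pow_pow _ _).eq
  have UU' : ∀ p p' : ZMod 2, u ^ p.val * u ^ p'.val = u ^ (p + p').val := fun p p' => (invol_pow_add huu p p').symm
  have CC' : ∀ q q' : ZMod 2, c ^ q.val * c ^ q'.val = c ^ (q + q').val := fun q q' => (invol_pow_add hcc q q').symm
  have AA' : ∀ i i' : ZMod 2, a ^ i.val * a ^ i'.val =
      u ^ (α₁ * (i * i')).val * (c ^ (α₂ * (i * i')).val * a ^ (i + i').val) := fun i i' => by
    have h := AA i i' 1; simp only [mul_one] at h; exact h
  have BA' : ∀ j i : ZMod 2, b ^ j.val * a ^ i.val =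
      a ^ i.val * (b ^ j.val * (u ^ (γ₁ * (j * i)).val * c ^ (γ₂ * (j * i)).val)) := fun j i => by
    have h := BA j i 1; simp only [mul_one] at h; exact h
  set f : ZMod 2 × ZMod 2 × ZMod 2 × ZMod 2 × ZMod 2 → G :=
    fun P => u ^ P.1.val * c ^ P.2.1.val * a ^ P.2.2.1.val * b ^ P.2.2.2.1.val * x ^ P.2.2.2.2.val with hf_def
  have massoc : ∀ g₁ g₂ g₃ : G, g₁ * g₂ * g₃ = g₁ * (g₂ * g₃) := mul_assoc
  have hf : ∀ P Q, f (mul P Q) = f P * f Q := by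
    rintro ⟨p, q, i, j, k⟩ ⟨p', q', i', j', k'⟩
    rw [hm]
    simp only [hf_def]
    symm
    simp only [massoc]
    simp only [XA, XB, XU, XC, XX', AA, BB, BA, AU, BU, AC, BC, CU, UU, CC]
  -- words in `u, c, a, b` commute with `u`; words with `x` conjugate `u` to `uc`
  have hMu : ∀ (p q i j s : ZMod 2), u ^ p.val * c ^ q.val * a ^ i.val * b ^ j.val * u ^ s.val =
      u ^ s.val * (u ^ p.val * c ^ q.val * a ^ i.val * b ^ j.val) := by
    intro p q i j s
    simp only [mul_assoc, BU', AU, CU, UU]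
    rw [add_comm]
  have hMxu : ∀ (p q i j s : ZMod 2), u ^ p.val * c ^ q.val * a ^ i.val * b ^ j.val * x * u ^ s.val =
      u ^ s.val * (c ^ s.val * (u ^ p.val * c ^ q.val * a ^ i.val * b ^ j.val * x)) := by
    intro p q i j s
    have h := XU 1 s 1
    simp only [hv1, pow_one, mul_one, one_mul] at h
    simp only [mul_assoc, h, BU, BC, AU, AC, CU, CC, UU]
    rw [add_comm q s, add_comm p s]
  have hinvU : ∀ s : ZMod 2, (u ^ s.val)⁻¹ = u ^ s.val := fun s => by
    rw [inv_eq_iff_mul_eq_one, ← invol_pow_add huu, show (s + s).val = 0 from by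
      rcases zmod2_cases s with rfl | rfl <;> rfl, pow_zero]
  have hinvC : ∀ s : ZMod 2, (c ^ s.val)⁻¹ = c ^ s.val := fun s => by
    rw [inv_eq_iff_mul_eq_one, ← invol_pow_add hcc, show (s + s).val = 0 from by
      rcases zmod2_cases s with rfl | rfl <;> rfl, pow_zero]
  have hinvA := inv_bits huu hcc (hcen u) haa
  have hinj : Function.Injective f := by
    rintro ⟨p, q, i, j, k⟩ ⟨p', q', i', j', k'⟩ h
    simp only [hf_def] at h
    -- equal `k`: words without `x` commute with `u`, words with `x` conjugate `u` to `uc`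
    have hkk : k = k' := by
      rcases zmod2_cases k with rfl | rfl <;> rcases zmod2_cases k' with rfl | rfl
      · rfl
      · exfalso
        rw [hv0, hv1, pow_zero, pow_one, mul_one] at h
        have h1 := hMu p q i j 1
        have h2 := hMxu p' q' i' j' 1
        simp only [hv1, pow_one] at h1 h2
        rw [h] at h1
        rw [h1] at h2
        have h3 := mul_left_cancel h2
        exact hc1 (mul_right_cancel (h3.symm.trans (one_mul _).symm))
      · exfalso
        rw [hv0, hv1, pow_zero, pow_one, mul_one] at h
        have h1 := hMu p' q' i' j' 1
        have h2 := hMxu p q i j 1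
        simp only [hv1, pow_one] at h1 h2
        rw [← h] at h1
        rw [h1] at h2
        have h3 := mul_left_cancel h2
        exact hc1 (mul_right_cancel (h3.symm.trans (one_mul _).symm))
      · rfl
    subst hkk
    have hM : u ^ p.val * c ^ q.val * a ^ i.val * b ^ j.val = u ^ p'.val * c ^ q'.val * a ^ i'.val * b ^ j'.val :=
      mul_right_cancel h
    -- equal `j`: otherwise `b` is a word in `u, c, a`
    have hjj : j = j' := by
      rcases zmod2_cases j with rfl | rfl <;> rcases zmod2_cases j' with rfl | rfl
      · rfl
      · exfalso
        rw [hv0, hv1, pow_zero, pow_one, mul_one] at hM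
        have hb' : b = (u ^ p'.val * c ^ q'.val * a ^ i'.val)⁻¹ * (u ^ p.val * c ^ q.val * a ^ i.val) :=
          eq_inv_mul_of_mul_eq hM.symm
        rw [mul_inv_rev, mul_inv_rev, hinvA, hinvU, hinvC] at hb'
        simp only [mul_assoc, AU, AC, CU, UU, CC, AA', AC', CU'] at hb'
        exact hb _ _ _ hb'
      · exfalso
        rw [hv0, hv1, pow_zero, pow_one, mul_one] at hM
        have hb' : b = (u ^ p.val * c ^ q.val * a ^ i.val)⁻¹ * (u ^ p'.val * c ^ q'.val * a ^ i'.val) :=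
          eq_inv_mul_of_mul_eq hM
        rw [mul_inv_rev, mul_inv_rev, hinvA, hinvU, hinvC] at hb'
        simp only [mul_assoc, AU, AC, CU, UU, CC, AA', AC', CU'] at hb'
        exact hb _ _ _ hb'
      · rfl
    subst hjj
    have hM2 : u ^ p.val * c ^ q.val * a ^ i.val = u ^ p'.val * c ^ q'.val * a ^ i'.val := mul_right_cancel hM
    -- equal `i`: otherwise `a` is a word in `u, c`
    have hii : i = i' := by
      rcases zmod2_cases i with rfl | rfl <;> rcases zmod2_cases i' with rfl | rfl
      · rfl
      · exfalso
        rw [hv0, hv1, pow_zero, pow_one, mul_one] at hM2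
        have ha' : a = (u ^ p'.val * c ^ q'.val)⁻¹ * (u ^ p.val * c ^ q.val) := eq_inv_mul_of_mul_eq hM2.symm
        rw [mul_inv_rev, hinvU, hinvC] at ha'
        simp only [mul_assoc, CU, UU, CU', CC'] at ha'
        exact ha _ _ ha'
      · exfalso
        rw [hv0, hv1, pow_zero, pow_one, mul_one] at hM2
        have ha' : a = (u ^ p.val * c ^ q.val)⁻¹ * (u ^ p'.val * c ^ q'.val) := eq_inv_mul_of_mul_eq hM2
        rw [mul_inv_rev, hinvU, hinvC] at ha'
        simp only [mul_assoc, CU, UU, CU', CC'] at ha'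
        exact ha _ _ ha'
      · rfl
    subst hii
    have hM3 : u ^ p.val * c ^ q.val = u ^ p'.val * c ^ q'.val := mul_right_cancel hM2
    -- equal `p`: otherwise `u` is a power of `c`
    have hpp : p = p' := by
      rcases zmod2_cases p with rfl | rfl <;> rcases zmod2_cases p' with rfl | rfl
      · rfl
      · exfalso
        rw [hv0, hv1, pow_zero, pow_one, one_mul] at hM3
        have hu' : u = c ^ q.val * (c ^ q'.val)⁻¹ := eq_mul_inv_of_mul_eq hM3.symm
        rw [hinvC, CC'] at hu'
        exact hu _ hu'
      · exfalso
        rw [hv0, hv1, pow_zero, pow_one, one_mul] at hM3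
        have hu' : u = c ^ q'.val * (c ^ q.val)⁻¹ := eq_mul_inv_of_mul_eq hM3
        rw [hinvC, CC'] at hu'
        exact hu _ hu'
      · rfl
    subst hpp
    have hM4 : c ^ q.val = c ^ q'.val := mul_left_cancel hM3
    have hqq : q = q' := by
      rcases zmod2_cases q with rfl | rfl <;> rcases zmod2_cases q' with rfl | rfl
      · rfl
      · exfalso; rw [hv0, hv1, pow_zero, pow_one] at hM4; exact hc1 hM4.symm
      · exfalso; rw [hv0, hv1, pow_zero, pow_one] at hM4; exact hc1 hM4
      · rfl
    subst hqq
    rfl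
  obtain ⟨e, he, hef⟩ := exists_table_equiv_of_words_inj mul f hf hinj (by rw [hcard]; simp [ZMod.card])
  exact ⟨e, he, fun P => hef P⟩

end Summit.HodgeConjecture.CorCM.GaloisModels.CentraliserExtension
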